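import Literature.NumberTheory.EllipticCurves.CyclotomicPAdicLFunctionWeightK
import Literature.NumberTheory.EllipticCurves.PAdicLFunctionInterpolationProofs
import HarnessLib

/-!
# The modular-symbol distribution of a period–symbol datum (Mazur–Tate–Teitelbaum 1986, §I.10,
# weight `k`, `ℚ̄_p` coefficients): distribution relation, boundedness, special values

Topic `Literature/NumberTheory/EllipticCurves`, namespace
`Literature.NumberTheory.EllipticCurves.ModularForms`.

Towards the discharge of the named fact `exists_isCycPAdicLFunctionWeightK`
(`CyclotomicPAdicLFunctionWeightK.lean`).  For a newform `g ∈ S_k(Γ₀(M))`, `p ∤ M`, an embedding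
`ι : K_g → ℚ̄_p`, a unit root `υ` of `X² − ι(a_p)X + p^{k−1}` and a period–symbol datum
`D = (Ω, σ)` (`Im ∫_r^{i∞} g dz = σ(r) Ω`), the `ℚ̄_p`-valued family

  `μ(a + pᵐℤ_p) = υ^{−m} · ( ι σ(a/pᵐ) − p^{k−2} υ^{−1} · ι σ(a/p^{m−1}) )`     (`a = a.val`)

is the `s = 1` (moment `j = 0`) Mazur–Tate–Teitelbaum measure of the `p`-stabilisation
`g(z) − p^{k−1}υ^{−1} g(pz)` (`U_p`-eigenvalue `υ`; MTT §I.10 (10.1), the tree's weight-`2`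
`msdMeasure` with `[r]⁺ ↦ ι σ(r)` and `p ↦ p^{k−1}`).  This file proves, with the family entering
through a defining hypothesis `hμ` (no new definitions):

* `PeriodSymbolDatum.σ_add_intCast` — `σ(r + n) = σ(r)` on admissible cusps (`∫_{r+1}^{i∞} = ∫_r^{i∞}`);
* `sum_rayMoment_zero_add_div`, `PeriodSymbolDatum.sum_σ_add_div` — the Hecke relation
  `∑_{t mod p} σ((x + t)/p) = a_p σ(x) − p^{k−2} σ(px)` (`T_p g = a_p g`, `a_p` real), from the
  tree's `sum_Wsum_iota_one` at moment `0`;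
* `sum_fiber_mttDatum` — the distribution relation, reducing to `υ² − ι(a_p)υ + p^{k−1} = 0`;
* `norm_mttDatum_le`, `mttDatum_mem_padicCoeffField` — boundedness from bounded symbols
  (`‖υ‖ = 1`) and values in `ℚ_p(ι K_g, υ)`;
* `mttDatum_zero_sub_one`, `sum_mul_mttDatum_of_isPrimitive` — the two special values entering
  the interpolation property (14.3): `μ(ℤ_p) − μ(pℤ_p) = (1 − υ⁻¹)(1 − p^{k−2}υ⁻¹) ι σ(0)` and, for
  `χ` primitive of conductor `pᵐ`, `m ≥ 1`, `∑_a χ(a) μ(a + pᵐℤ_p) = υ^{−m} ∑_a χ(a) ι σ(a/pᵐ)`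
  (the second term of `μ` is constant on the cosets modulo `p^{m−1}`, over which `χ` sums to `0`).

Everything is proved; there are no named facts.

References: B. Mazur, J. Tate, J. Teitelbaum, Invent. Math. 84 (1986), §I.4 (4.2), §I.10
(10.1)–(10.2), §I.11, §I.14 (14.3); W. Stein, C. Wuthrich, *Algorithms for the arithmetic of
elliptic curves using Iwasawa theory*, Math. Comp. 82 (2013), (3.2)–(3.5).
-/

noncomputable section

open scoped MatrixGroups ModularForm
open CongruenceSubgroup Complex
open UpperHalfPlane hiding I

namespace Literature.NumberTheory.EllipticCurves.ModularForms

open Literature.NumberTheory.EllipticCurves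

/-! ### Periodicity of the symbols on admissible cusps -/

section Periodicity

variable {N : ℕ} [NeZero N] {k : ℤ}

/-- `∫_{r+n}^{i∞} f(z) dz = ∫_r^{i∞} f(z) dz` for `n ∈ ℕ` (`f(z + 1) = f(z)`; the tree's
`rayMoment_add_one` at moment `0`). [cite: Manin1973, §1] -/
theorem rayMoment_zero_add_natCast (f : CuspForm (Gamma0 N) k) (r : ℚ) (n : ℕ) :
    rayMoment (⇑f) 0 (((r + n : ℚ)) : ℝ) = rayMoment (⇑f) 0 (r : ℝ) := by
  induction n with
  | zero => simp
  | succ n ih =>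
    have h := rayMoment_add_one f 0 (r + n)
    simp only [zero_add, Finset.sum_range_one, Nat.choose_self, Nat.cast_one, one_mul] at h
    rw [← ih, ← h]
    push_cast
    ring_nf

/-- `∫_{r+n}^{i∞} f(z) dz = ∫_r^{i∞} f(z) dz` for `n ∈ ℤ`. [cite: Manin1973, §1] -/
theorem rayMoment_zero_add_intCast (f : CuspForm (Gamma0 N) k) (r : ℚ) (n : ℤ) :
    rayMoment (⇑f) 0 (((r + n : ℚ)) : ℝ) = rayMoment (⇑f) 0 (r : ℝ) := by
  obtain ⟨m, rfl | rfl⟩ := Int.eq_nat_or_neg n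
  · exact_mod_cast rayMoment_zero_add_natCast f r m
  · have h := rayMoment_zero_add_natCast f (r + (-(m : ℤ) : ℤ)) m
    push_cast at h ⊢
    rw [← h]
    ring_nf

variable {g : CuspForm (Gamma0 N) k}

/-- **`σ(r + n) = σ(r)`** for an admissible cusp `r` (`gcd(den r, N) = 1`) and `n ∈ ℤ`: both are
`Im ∫_r^{i∞} g dz / Ω` (Mazur–Tate–Teitelbaum 1986, §I.4 (4.2): `[r]` depends on `r mod 1`).
[cite: MazurTateTeitelbaum1986Invent, §I.4 (4.2)] -/
theorem PeriodSymbolDatum.σ_add_intCast (D : PeriodSymbolDatum g) {r : ℚ}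
    (hr : IsCoprime (r.den : ℤ) (N : ℤ)) (n : ℤ) : D.σ (r + n) = D.σ r := by
  have hr' : IsCoprime ((r + n).den : ℤ) (N : ℤ) := by rwa [Rat.add_intCast_den]
  have h1 := D.im_rayMoment_eq (r + n) hr'
  have h2 := D.im_rayMoment_eq r hr
  rw [rayMoment_zero_add_intCast, h2] at h1
  have hΩ : (D.Ω : ℂ) ≠ 0 := by exact_mod_cast D.Ω_ne_zero
  have h := mul_right_cancel₀ hΩ h1
  exact_mod_cast h.symm

end Periodicity

/-! ### The Hecke relation at moment `0` -/

section Hecke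

variable {N : ℕ} [NeZero N] {p : ℕ} [Fact p.Prime] {k : ℤ}

omit [NeZero N] [Fact p.Prime] in
/-- At moment `0` the weighted sum is the plain ray integral: `Wsum D 0 c x = ∫_x^{i∞} D(z) dz`. [folklore]
[cite: MazurTateTeitelbaum1986Invent, §I.10] -/
theorem Wsum_zero_left {L : ℕ} (D : CuspForm (Gamma0 L) k) (c x : ℚ) :
    Wsum D 0 c x = rayMoment ⇑D 0 x := by
  rw [Wsum_def]
  simp

/-- **The Hecke relation for the ray integrals** (`p ∤ N`, `T_p g = a_p g`):
`∑_{t mod p} ∫_{(x+t)/p}^{i∞} g dz = a_p ∫_x^{i∞} g dz − p^{k−2} ∫_{px}^{i∞} g dz` — the tree's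
`sum_Wsum_iota_one` (`U_p ι₁ g = a_p ι₁ g − p^{k−1} ι_p g`) at moment `0`, the cusps `(x − t)/p`
reflected to `(x + t)/p` by `1`-periodicity (Mazur–Tate–Teitelbaum 1986, §I.4 (4.2)).
[cite: MazurTateTeitelbaum1986Invent, §I.4 (4.2)] -/
theorem sum_rayMoment_zero_add_div (hpN : ¬ p ∣ N) (g : CuspForm (Gamma0 N) k) {ap : ℂ}
    (hT : (haveI : NeZero p := ⟨(Fact.out : p.Prime).ne_zero⟩; heckeT (Gamma0 N) k p g) = ap • g)
    (x : ℚ) :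
    ∑ t : Fin p, rayMoment ⇑g 0 ((((x + t) / p : ℚ)) : ℝ) =
      ap * rayMoment ⇑g 0 (x : ℝ) -
        (p : ℂ) ^ (k - 1) * (p : ℂ)⁻¹ * rayMoment ⇑g 0 ((((p : ℚ) * x : ℚ)) : ℝ) := by
  have hp : p.Prime := Fact.out
  haveI : NeZero p := ⟨hp.ne_zero⟩
  have h := sum_Wsum_iota_one hpN g hT 0 1 x
  simp only [Wsum_zero_left, mul_one] at h
  have h1 : ∀ y : ℚ, rayMoment ⇑(iota N (N * p) 1 k (mul_dvd_mul_left N (one_dvd p)) g) 0 (y : ℝ) =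
      rayMoment ⇑g 0 (y : ℝ) := fun y ↦ by rw [rayMoment_iota]; simp
  have h2 : rayMoment ⇑(iota N (N * p) p k dvd_rfl g) 0 (x : ℝ) =
      (p : ℂ)⁻¹ * rayMoment ⇑g 0 ((((p : ℚ) * x : ℚ)) : ℝ) := by
    rw [rayMoment_iota]; push_cast; ring_nf
  simp only [h1, h2] at h
  have hper : ∀ y : ℚ, rayMoment ⇑g 0 (((y + 1 : ℚ)) : ℝ) = rayMoment ⇑g 0 (y : ℝ) := fun y ↦ by
    exact_mod_cast rayMoment_zero_add_natCast g y 1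
  rw [← sum_fin_reflect_of_periodic p (fun y : ℚ ↦ rayMoment ⇑g 0 (y : ℝ)) hper x, h]
  ring

variable {g : CuspForm (Gamma0 N) k}

/-- **The Hecke relation for the symbols of a period–symbol datum** (`g` a newform, `p ∤ N`,
`k ≥ 2`): for an admissible `x` with `(x + t)/p` (`t mod p`) and `px` admissible,
`∑_{t mod p} σ((x + t)/p) = a_p σ(x) − p^{k−2} σ(px)` in `K_g` — imaginary parts of
`sum_rayMoment_zero_add_div` (`a_p` is real, `IsNewform0.cuspCoeff_im_eq_zero`) divided by `Ω`
(Mazur–Tate–Teitelbaum 1986, §I.4 (4.2) / §I.10 Prop.). [cite: MazurTateTeitelbaum1986Invent, §I.4 (4.2)] -/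
theorem PeriodSymbolDatum.sum_σ_add_div (D : PeriodSymbolDatum g) (hg : IsNewform0 g)
    (hpN : ¬ p ∣ N) (hk : 2 ≤ k) {x : ℚ} (hx : IsCoprime (x.den : ℤ) (N : ℤ))
    (hxt : ∀ t : Fin p, IsCoprime ((((x + t) / p : ℚ)).den : ℤ) (N : ℤ))
    (hpx : IsCoprime ((((p : ℚ) * x : ℚ)).den : ℤ) (N : ℤ)) :
    ∑ t : Fin p, D.σ ((x + t) / p) =
      ⟨(qExpansion 1 ⇑g).coeff p, coeff_mem_coeffField g p⟩ * D.σ x -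
        (p : coeffField g) ^ (k - 2).toNat * D.σ ((p : ℚ) * x) := by
  have hp : p.Prime := Fact.out
  haveI : NeZero p := ⟨hp.ne_zero⟩
  have hp0 : (p : ℂ) ≠ 0 := by exact_mod_cast hp.ne_zero
  have h := sum_rayMoment_zero_add_div hpN g (hg.heckeT_eq_coeff_smul hp) x
  -- `p^{k-1} p^{-1} = p^{k-2} = p^{(k-2).toNat}`
  have hpow : (p : ℂ) ^ (k - 1) * (p : ℂ)⁻¹ = (((p ^ (k - 2).toNat : ℕ) : ℝ) : ℂ) := by
    rw [← zpow_sub_one₀ hp0, show k - 1 - 1 = ((k - 2).toNat : ℤ) by omega, zpow_natCast]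
    push_cast; ring
  have hreal : ((qExpansion 1 ⇑g).coeff p).im = 0 := hg.cuspCoeff_im_eq_zero p
  have hap : (qExpansion 1 ⇑g).coeff p = ((((qExpansion 1 ⇑g).coeff p).re : ℝ) : ℂ) :=
    Complex.ext (by simp) (by simp [hreal])
  rw [hpow, hap] at h
  -- imaginary parts
  have him := congr_arg Complex.im h
  rw [Complex.im_sum, sub_im, im_ofReal_mul, im_ofReal_mul] at him
  -- substitute the datum
  have himC := congr_arg ((↑) : ℝ → ℂ) him
  simp only [ofReal_sum, ofReal_sub, ofReal_mul] at himC
  rw [D.im_rayMoment_eq x hx, D.im_rayMoment_eq _ hpx] at himC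
  rw [Finset.sum_congr rfl fun t _ ↦ D.im_rayMoment_eq _ (hxt t)] at himC
  have hΩ : (D.Ω : ℂ) ≠ 0 := by exact_mod_cast D.Ω_ne_zero
  rw [← Finset.sum_mul, ← hap, show ((qExpansion 1 ⇑g).coeff p) * ((D.σ x : ℂ) * D.Ω) -
      (((p ^ (k - 2).toNat : ℕ) : ℝ) : ℂ) * ((D.σ ((p : ℚ) * x) : ℂ) * D.Ω) =
      (((qExpansion 1 ⇑g).coeff p) * (D.σ x : ℂ) -
        (((p ^ (k - 2).toNat : ℕ) : ℝ) : ℂ) * (D.σ ((p : ℚ) * x) : ℂ)) * D.Ω by ring] at himC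
  have key := mul_right_cancel₀ hΩ himC
  apply Subtype.ext
  push_cast
  rw [key]
  push_cast
  ring

end Hecke

/-! ### The distribution of a datum: relation, boundedness, values -/

section Distribution

variable {N : ℕ} [NeZero N] {p : ℕ} [Fact p.Prime] {k : ℤ} {g : CuspForm (Gamma0 N) k}
  (D : PeriodSymbolDatum g) (ι : coeffField g →+* PadicAlgCl p) {υ : PadicAlgCl p}
  {μ : (m : ℕ) → ZMod (p ^ m) → PadicAlgCl p}

omit [NeZero N] in
/-- The defining formula of the moment-`0` Mazur–Tate–Teitelbaum distribution of the datum `D`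
along `ι` with unit root `υ` (MTT §I.10 (10.1), weight `k`): used as a hypothesis `hμ` below.
[cite: MazurTateTeitelbaum1986Invent, §I.10 (10.1)] -/
theorem mttDatum_congr
    (hμ : ∀ (m : ℕ) (a : ZMod (p ^ m)), μ m a = υ⁻¹ ^ m *
      (ι (D.σ ((a.val : ℚ) / (p : ℚ) ^ m)) -
        (p : PadicAlgCl p) ^ (k - 2).toNat * υ⁻¹ * ι (D.σ ((p : ℚ) * ((a.val : ℚ) / (p : ℚ) ^ m)))))
    (m : ℕ) (a : ZMod (p ^ m)) :
    μ m a = υ⁻¹ ^ m * (ι (D.σ ((a.val : ℚ) / (p : ℚ) ^ m)) -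
      (p : PadicAlgCl p) ^ (k - 2).toNat * υ⁻¹ * ι (D.σ ((p : ℚ) * ((a.val : ℚ) / (p : ℚ) ^ m)))) :=
  hμ m a

/-- **The distribution relation** (Mazur–Tate–Teitelbaum 1986, §I.10, Prop. (10.2)): for a
newform `g` of weight `k ≥ 2` and level prime to `p`, and `υ ≠ 0` with `υ² − ι(a_p)υ + p^{k−1} = 0`,
`∑_{b ≡ a mod pᵐ} μ(b + p^{m+1}ℤ_p) = μ(a + pᵐℤ_p)`.  The classes over `a` are `a + pᵐt`, `t < p`,
with cusps `(x + t)/p`, `x = a/pᵐ`; the Hecke relation `sum_σ_add_div` and `σ(x + t) = σ(x)`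
reduce the claim to `(ι(a_p) − p^{k−1}υ⁻¹) = υ`. [cite: MazurTateTeitelbaum1986Invent, §I.10 Prop. (10.2)] -/
theorem sum_fiber_mttDatum (hg : IsNewform0 g) (hpN : ¬ p ∣ N) (hk : 2 ≤ k)
    (hυ : υ ^ 2 - ι ⟨(qExpansion 1 ⇑g).coeff p, coeff_mem_coeffField g p⟩ * υ +
      (p : PadicAlgCl p) ^ (k - 1).toNat = 0) (hυ0 : υ ≠ 0)
    (hμ : ∀ (m : ℕ) (a : ZMod (p ^ m)), μ m a = υ⁻¹ ^ m *
      (ι (D.σ ((a.val : ℚ) / (p : ℚ) ^ m)) -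
        (p : PadicAlgCl p) ^ (k - 2).toNat * υ⁻¹ * ι (D.σ ((p : ℚ) * ((a.val : ℚ) / (p : ℚ) ^ m)))))
    (m : ℕ) (a : ZMod (p ^ m)) :
    ∑ b ∈ Finset.univ.filter (fun b : ZMod (p ^ (m + 1)) ↦
        ZMod.castHom (pow_dvd_pow p m.le_succ) (ZMod (p ^ m)) b = a), μ (m + 1) b = μ m a := by
  classical
  have hp : p.Prime := Fact.out
  haveI : NeZero p := ⟨hp.ne_zero⟩
  have hp0 : (p : ℚ) ≠ 0 := by exact_mod_cast hp.ne_zero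
  -- the fibre and its parametrisation
  have hinj : Function.Injective
      (fun t : Fin p ↦ ((a.val + p ^ m * (t : ℕ) : ℕ) : ZMod (p ^ (m + 1)))) := by
    intro t t' h
    have hv := congr_arg ZMod.val h
    simp only [val_classLift] at hv
    exact Fin.ext (Nat.eq_of_mul_eq_mul_left (pow_pos hp.pos m) (by omega))
  rw [filter_castHom_eq_image, Finset.sum_image fun t _ t' _ h ↦ hinj h]
  -- the cusps
  set x : ℚ := (a.val : ℚ) / (p : ℚ) ^ m with hxdef
  have hxt : ∀ t : Fin p,
      ((((a.val + p ^ m * (t : ℕ) : ℕ) : ZMod (p ^ (m + 1))).val : ℚ)) / (p : ℚ) ^ (m + 1) =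
        (x + t) / p := by
    intro t
    rw [val_classLift, hxdef]
    push_cast
    field_simp
    ring
  have hpxt : ∀ t : Fin p, (p : ℚ) * ((x + t) / p) = x + ((t : ℕ) : ℤ) := by
    intro t; field_simp; push_cast; ring
  -- admissibility of the cusps
  have hx : IsCoprime (x.den : ℤ) (N : ℤ) := by
    have := isCoprime_den_div_pow p hpN (a.val : ℤ) m
    push_cast at this; exact this
  have hxt' : ∀ t : Fin p, IsCoprime ((((x + t) / p : ℚ)).den : ℤ) (N : ℤ) := by
    intro t
    have e : (x + t) / p = (((a.val : ℤ) + (p : ℤ) ^ m * (t : ℕ) : ℤ) : ℚ) / (p : ℚ) ^ (m + 1) := by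
      rw [hxdef]; push_cast; field_simp; ring
    rw [e]; exact isCoprime_den_div_pow p hpN _ (m + 1)
  have hpx : IsCoprime ((((p : ℚ) * x : ℚ)).den : ℤ) (N : ℤ) := by
    have e : (p : ℚ) * x = (((a.val : ℤ) * p : ℤ) : ℚ) / (p : ℚ) ^ m := by
      rw [hxdef]; push_cast; ring
    rw [e]; exact isCoprime_den_div_pow p hpN _ m
  simp only [hμ, hxt, hpxt]
  simp_rw [D.σ_add_intCast hx]
  rw [← Finset.mul_sum, Finset.sum_sub_distrib, Finset.sum_const, Finset.card_univ,
    Fintype.card_fin, ← map_sum, D.sum_σ_add_div hg hpN hk hx hxt' hpx, map_sub, map_mul, map_mul,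
    map_pow, map_natCast]
  -- the algebra
  set sx := ι (D.σ x)
  set spx := ι (D.σ ((p : ℚ) * x))
  have hap : ι ⟨(qExpansion 1 ⇑g).coeff p, coeff_mem_coeffField g p⟩ =
      υ + (p : PadicAlgCl p) ^ (k - 1).toNat * υ⁻¹ := by
    have h1 : ι ⟨(qExpansion 1 ⇑g).coeff p, coeff_mem_coeffField g p⟩ * υ =
        υ ^ 2 + (p : PadicAlgCl p) ^ (k - 1).toNat := by linear_combination -hυ
    calc ι ⟨(qExpansion 1 ⇑g).coeff p, coeff_mem_coeffField g p⟩
        = (ι ⟨(qExpansion 1 ⇑g).coeff p, coeff_mem_coeffField g p⟩ * υ) * υ⁻¹ := by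
          rw [mul_assoc, mul_inv_cancel₀ hυ0, mul_one]
      _ = υ + (p : PadicAlgCl p) ^ (k - 1).toNat * υ⁻¹ := by
          rw [h1, add_mul, pow_two, mul_assoc, mul_inv_cancel₀ hυ0, mul_one]
  have hk1 : (k - 1).toNat = (k - 2).toNat + 1 := by omega
  have hυi : υ⁻¹ * υ = 1 := inv_mul_cancel₀ hυ0
  rw [hap, hk1, nsmul_eq_mul]
  linear_combination (υ⁻¹ ^ m * sx) * hυi

omit [NeZero N] in
/-- **Boundedness** (Mazur–Tate–Teitelbaum 1986, §I.11: the measure of a unit-root stabilisation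
is bounded): if `‖ι σ(r)‖ ≤ B` for all admissible `r` and `‖υ‖ = 1` then `‖μ(a + pᵐℤ_p)‖ ≤ 2B`.
[cite: MazurTateTeitelbaum1986Invent, §I.11] -/
theorem norm_mttDatum_le (hpN : ¬ p ∣ N) {B : ℝ}
    (hB : ∀ r : ℚ, IsCoprime (r.den : ℤ) (N : ℤ) → ‖ι (D.σ r)‖ ≤ B) (hυ1 : ‖υ‖ = 1)
    (hμ : ∀ (m : ℕ) (a : ZMod (p ^ m)), μ m a = υ⁻¹ ^ m *
      (ι (D.σ ((a.val : ℚ) / (p : ℚ) ^ m)) -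
        (p : PadicAlgCl p) ^ (k - 2).toNat * υ⁻¹ * ι (D.σ ((p : ℚ) * ((a.val : ℚ) / (p : ℚ) ^ m)))))
    (m : ℕ) (a : ZMod (p ^ m)) : ‖μ m a‖ ≤ 2 * B := by
  have hp : p.Prime := Fact.out
  have hx : IsCoprime ((((a.val : ℚ) / (p : ℚ) ^ m : ℚ)).den : ℤ) (N : ℤ) := by
    have := isCoprime_den_div_pow p hpN (a.val : ℤ) m
    push_cast at this; exact this
  have hpx : IsCoprime ((((p : ℚ) * ((a.val : ℚ) / (p : ℚ) ^ m) : ℚ)).den : ℤ) (N : ℤ) := by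
    have e : (p : ℚ) * ((a.val : ℚ) / (p : ℚ) ^ m) = (((a.val : ℤ) * p : ℤ) : ℚ) / (p : ℚ) ^ m := by
      push_cast; ring
    rw [e]; exact isCoprime_den_div_pow p hpN _ m
  have hυi : ‖υ⁻¹‖ = 1 := by rw [norm_inv, hυ1, inv_one]
  have hpe : ‖(p : PadicAlgCl p) ^ (k - 2).toNat * υ⁻¹‖ ≤ 1 := by
    rw [norm_mul, norm_pow, hυi, mul_one]
    have : ‖(p : PadicAlgCl p)‖ ≤ 1 := by
      rw [← map_natCast (algebraMap ℚ_[p] (PadicAlgCl p)), norm_algebraMap']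
      exact (Padic.norm_p_lt_one (p := p)).le
    exact pow_le_one₀ (norm_nonneg _) this
  rw [hμ, norm_mul, norm_pow, hυi, one_pow, one_mul]
  refine (norm_sub_le _ _).trans ?_
  rw [two_mul]
  refine add_le_add (hB _ hx) ?_
  rw [norm_mul]
  calc _ ≤ 1 * B := mul_le_mul hpe (hB _ hpx) (norm_nonneg _) zero_le_one
    _ = B := one_mul B

omit [NeZero N] in
/-- **The values lie in `ℚ_p(ι K_g, υ)`** (`padicCoeffField (Set.range ι ∪ {υ})`; Mazur–Tate–
Teitelbaum 1986, §I.10: `μ_{f,α}` takes values in `(1/α^∞)𝒪_f`). [cite: MazurTateTeitelbaum1986Invent, §I.10] -/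
theorem mttDatum_mem_adjoin
    (hμ : ∀ (m : ℕ) (a : ZMod (p ^ m)), μ m a = υ⁻¹ ^ m *
      (ι (D.σ ((a.val : ℚ) / (p : ℚ) ^ m)) -
        (p : PadicAlgCl p) ^ (k - 2).toNat * υ⁻¹ * ι (D.σ ((p : ℚ) * ((a.val : ℚ) / (p : ℚ) ^ m)))))
    (m : ℕ) (a : ZMod (p ^ m)) :
    μ m a ∈ IntermediateField.adjoin ℚ_[p] (Set.range ι ∪ {υ}) := by
  set F := IntermediateField.adjoin ℚ_[p] (Set.range ι ∪ {υ})
  have hυF : υ ∈ F := IntermediateField.subset_adjoin _ _ (Or.inr rfl)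
  have hιF : ∀ y, ι y ∈ F := fun y ↦ IntermediateField.subset_adjoin _ _ (Or.inl ⟨y, rfl⟩)
  have hυiF : υ⁻¹ ∈ F := inv_mem hυF
  rw [hμ]
  refine mul_mem (pow_mem hυiF _) (sub_mem (hιF _) (mul_mem (mul_mem ?_ hυiF) (hιF _)))
  exact pow_mem (natCast_mem F p) _

omit [NeZero N] in
/-- **`μ(ℤ_p) − μ(pℤ_p) = (1 − υ⁻¹)(1 − p^{k−2}υ⁻¹) · ι σ(0)`** — the constant term of the
transform, the first clause of (14.3) (both balls sit over the cusp `0`).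
[cite: MazurTateTeitelbaum1986Invent, §I.14 (14.3)] -/
theorem mttDatum_zero_sub_one
    (hμ : ∀ (m : ℕ) (a : ZMod (p ^ m)), μ m a = υ⁻¹ ^ m *
      (ι (D.σ ((a.val : ℚ) / (p : ℚ) ^ m)) -
        (p : PadicAlgCl p) ^ (k - 2).toNat * υ⁻¹ * ι (D.σ ((p : ℚ) * ((a.val : ℚ) / (p : ℚ) ^ m))))) :
    μ 0 0 - μ 1 0 =
      (1 - υ⁻¹) * (1 - (p : PadicAlgCl p) ^ (k - 2).toNat * υ⁻¹) * ι (D.σ 0) := by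
  rw [hμ, hμ, ZMod.val_zero, ZMod.val_zero]
  simp only [Nat.cast_zero, zero_div, mul_zero, pow_zero, one_mul, pow_one]
  ring

/-- The second symbol of `μ` at level `pᵐ⁺¹` only depends on the class modulo `pᵐ`:
`σ(p · a/p^{m+1}) = σ(a₀/pᵐ)`, `a₀ = a mod pᵐ` (periodicity). [cite: MazurTateTeitelbaum1986Invent, §I.4 (4.2)] -/
theorem PeriodSymbolDatum.σ_mul_div_pow_succ (hpN : ¬ p ∣ N) (m : ℕ) (a : ZMod (p ^ (m + 1))) :
    D.σ ((p : ℚ) * ((a.val : ℚ) / (p : ℚ) ^ (m + 1))) =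
      D.σ ((((ZMod.castHom (pow_dvd_pow p m.le_succ) (ZMod (p ^ m)) a).val : ℚ)) / (p : ℚ) ^ m) := by
  have hp : p.Prime := Fact.out
  haveI : NeZero (p ^ (m + 1)) := ⟨pow_ne_zero _ hp.ne_zero⟩
  haveI : NeZero (p ^ m) := ⟨pow_ne_zero _ hp.ne_zero⟩
  have hp0 : (p : ℚ) ≠ 0 := by exact_mod_cast hp.ne_zero
  rw [ZMod.castHom_apply, ZMod.cast_eq_val, ZMod.val_natCast]
  have hdiv : a.val % p ^ m + p ^ m * (a.val / p ^ m) = a.val := Nat.mod_add_div _ _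
  have hq : (p : ℚ) * ((a.val : ℚ) / (p : ℚ) ^ (m + 1)) =
      ((a.val % p ^ m : ℕ) : ℚ) / (p : ℚ) ^ m + ((a.val / p ^ m : ℕ) : ℚ) := by
    conv_lhs => rw [← hdiv]
    push_cast
    field_simp
    ring
  have hadm : IsCoprime (((((a.val % p ^ m : ℕ) : ℚ) / (p : ℚ) ^ m : ℚ)).den : ℤ) (N : ℤ) := by
    have := isCoprime_den_div_pow p hpN ((a.val % p ^ m : ℕ) : ℤ) m
    push_cast at this; exact this
  rw [hq, show ((a.val / p ^ m : ℕ) : ℚ) = (((a.val / p ^ m : ℕ) : ℤ) : ℚ) from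
    (Int.cast_natCast _).symm, D.σ_add_intCast hadm]

/-- **Evaluation against a primitive character** (Mazur–Tate–Teitelbaum 1986, §I.14, proof of
(14.3); Stein–Wuthrich 2013, (3.5)): for `χ` primitive of conductor `p^{m+1}`,
`∑_{a mod p^{m+1}} χ(a) μ(a + p^{m+1}ℤ_p) = υ^{−(m+1)} ∑_a χ(a) ι σ(a/p^{m+1})`; the second term of
`μ` is constant on the cosets modulo `pᵐ` (`σ_mul_div_pow_succ`), over which `χ` sums to zero
(`sum_fiber_eq_zero_of_not_factorsThrough`). [cite: MazurTateTeitelbaum1986Invent, §I.14 (14.3)] -/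
theorem sum_mul_mttDatum_of_isPrimitive (hpN : ¬ p ∣ N)
    (hμ : ∀ (m : ℕ) (a : ZMod (p ^ m)), μ m a = υ⁻¹ ^ m *
      (ι (D.σ ((a.val : ℚ) / (p : ℚ) ^ m)) -
        (p : PadicAlgCl p) ^ (k - 2).toNat * υ⁻¹ * ι (D.σ ((p : ℚ) * ((a.val : ℚ) / (p : ℚ) ^ m)))))
    (m : ℕ) (χ : DirichletCharacter ℂ_[p] (p ^ (m + 1))) (hχ : χ.IsPrimitive) :
    ∑ a : ZMod (p ^ (m + 1)), χ a * algebraMap (PadicAlgCl p) ℂ_[p] (μ (m + 1) a) =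
      algebraMap (PadicAlgCl p) ℂ_[p] (υ⁻¹ ^ (m + 1)) * twistedSymbolSumK D ι χ := by
  classical
  have hp : p.Prime := Fact.out
  haveI : NeZero (p ^ (m + 1)) := ⟨pow_ne_zero _ hp.ne_zero⟩
  haveI : NeZero (p ^ m) := ⟨pow_ne_zero _ hp.ne_zero⟩
  -- the second term vanishes
  have hvan : ∑ a : ZMod (p ^ (m + 1)), χ a *
      algebraMap (PadicAlgCl p) ℂ_[p] (ι (D.σ ((p : ℚ) * ((a.val : ℚ) / (p : ℚ) ^ (m + 1))))) = 0 := by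
    rw [← Finset.sum_fiberwise Finset.univ
      (ZMod.castHom (pow_dvd_pow p m.le_succ) (ZMod (p ^ m)))]
    refine Finset.sum_eq_zero fun a₀ _ ↦ ?_
    have hconst : ∀ a ∈ Finset.univ.filter (fun a : ZMod (p ^ (m + 1)) ↦
        ZMod.castHom (pow_dvd_pow p m.le_succ) (ZMod (p ^ m)) a = a₀),
        χ a * algebraMap (PadicAlgCl p) ℂ_[p] (ι (D.σ ((p : ℚ) * ((a.val : ℚ) / (p : ℚ) ^ (m + 1))))) =
          χ a * algebraMap (PadicAlgCl p) ℂ_[p] (ι (D.σ (((a₀.val : ℚ)) / (p : ℚ) ^ m))) := by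
      intro a ha
      rw [D.σ_mul_div_pow_succ hpN m a, (Finset.mem_filter.mp ha).2]
    rw [Finset.sum_congr rfl hconst, ← Finset.sum_mul,
      sum_fiber_eq_zero_of_not_factorsThrough χ _ (not_factorsThrough_of_isPrimitive hχ
        (Nat.pow_lt_pow_right hp.one_lt m.lt_succ_self)) a₀, zero_mul]
  have hmain : ∀ a : ZMod (p ^ (m + 1)),
      χ a * algebraMap (PadicAlgCl p) ℂ_[p] (μ (m + 1) a) =
        algebraMap (PadicAlgCl p) ℂ_[p] (υ⁻¹ ^ (m + 1)) *
            (χ a * algebraMap (PadicAlgCl p) ℂ_[p] (ι (D.σ ((a.val : ℚ) / ((p ^ (m + 1) : ℕ) : ℚ))))) -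
          algebraMap (PadicAlgCl p) ℂ_[p] (υ⁻¹ ^ (m + 1) * ((p : PadicAlgCl p) ^ (k - 2).toNat * υ⁻¹)) *
            (χ a * algebraMap (PadicAlgCl p) ℂ_[p]
              (ι (D.σ ((p : ℚ) * ((a.val : ℚ) / (p : ℚ) ^ (m + 1)))))) := by
    intro a
    rw [hμ]
    simp only [map_sub, map_mul, Nat.cast_pow]
    ring
  rw [Finset.sum_congr rfl fun a _ ↦ hmain a, Finset.sum_sub_distrib, ← Finset.mul_sum,
    ← Finset.mul_sum, hvan, mul_zero, sub_zero, twistedSymbolSumK]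

end Distribution

end Literature.NumberTheory.EllipticCurves.ModularForms

end
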